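import Summits.QuantumFields.YangMills.Theorems.BalabanUVNodesK0RecordFormatNamesLemmas

/-!
# NODE O port PT-A, [RG-I] §1 FRAME — the COORDINATE DICTIONARY of the (S1) mould at the record's names:
# `FormatPlusG` over DEF-1's twelve record families follows, row for row, from pieces given on print's configuration
# pairs `(𝐔, 𝐉)` (`Sect2.CPair`) with the printed rows stated there; plus the pieces-free half of (1.19) PROVED at the record

Cell `ym-nodeO-ideate`, porter seat `ymgap-nodeO-port-PTA-1` (gen 0), director-ym №R610 PORT item `stmt-QuantumFields-27930`
`PortRecordRepresentationS1`; `--supports stmt-QuantumFields-27930` (helper; count-neutral).  [I] = [Balaban1987RG1].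

WHAT.  The signed text 27930 asks for `B12FormatPlus.FormatPlusG` at the record's names — pieces `E n X : ℂ^{M n} → ℂ` in the
COORDINATES `recordBondCount` of the pairs `(𝐔, 𝐉)` ([I] (1.9) p. 261), six rows.  Every section of [I] §2–§5 and [II] that
produces pieces produces them as functions of the configuration pair itself (the tree's `Sect2.CPair (F.P K) (MatA 2)`, the
currency of `Sect2.spaceI`, `Sect2.cAct`, `Sect2.agreeOnSet`).  This file does the transfer ONCE:
* §1 `decodeCfg` is a continuous linear map (`exists_decodeCLM`), `decodeCfg ∘ recordAct = cAct ∘ decodeCfg`,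
  `decodeCfg ∘ recordCoordProj = (window restriction) ∘ decodeCfg`, agreement on `recordCoords X` = `agreeOnSet (domSites X)`.
* §2 ★ `recordUc_mapsTo_recordAct` — the PIECES-FREE half of the (1.19) row `GaugeInv119` at the record («The spaces
  U^c_j(X, α₀, α₁) are, by the definition, gauge invariant also», p. 263), PROVED from `B12RegularSpaces111.act_mem_space`.
* §3 ★ `formatPlusG_record_of_cpairRows` — for ANY chart `χ`, functional `Φf`, embedding `ι` and volume offset `K₀`: pieces
  `Ep n X : Sect2.CPair → ℂ` that are analytic on the record space read in pairs, obey (1.18) there, depend on the pair through the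
  bonds of `X` (`agreeOnSet`), are invariant under (1.10) `cAct` for `SL(2, ℂ)`-valued gauge transformations, satisfy the
  two-volume identity through the window restriction of pairs, and represent `Φf` through `decodeCfg ∘ χ ∘ ι`, GIVE `FormatPlusG`
  at the record names with `E n X := Ep n X ∘ decodeCfg`.  Generic in `(m, χ, Φf, ι, K₀)`, so it serves the signed text
  (`K₀ := recordK₀ F Mc k`, `χ := recordChart`, `ι := recordEmb`) and any re-issue of the chart∕embedding pair alike.
* §4 receipts about the signed chart: `decodeCfg_recordChart_snd` — the `𝐉`-component of `recordChart` is identically `0`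
  (print's (1.9) evaluates the pieces at `𝐉_j = (1.8)(U_j)`, tree `B12Eq18Current.ofBackground`; recorded for the cell's critic,
  see the porter's PORT-PLAN §0), and `decodeCfg_recordChart_fst_of_not_mem` (off `X` the `𝐔`-component is `1`).

HONEST FRAMING.  Bookkeeping about NAMES and one definitional row of print; NO piece of Bałaban's is constructed, no estimate
of [I] §2–§5 is ported or discharged here; 27930 stays OPEN; K0⁷ NOT closed; NODE O 0∕1; COUNT 8∕28 · K 1∕4 UNMOVED; finite
`𝕋⁴_{L^K}` at fixed ε — NOT continuum ∕ OS ∕ Clay; **the Yang–Mills mass gap is NOT proved by any of this.**  No `sorry`, no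
`def`, no `instance`; standard axioms.

v4 (porter gen 2, APPEND-ONLY; §1–§6 byte-identical to ✓p793689): §7 CPair-rows ADDITIVITY — the (S1) mould at the record names (centred
layer) from TWO piece families `P + Q` on pairs with (1.18) constants `E₁ + E₂` (the assembly shape `Ep = LZ + FE`), and the finite-sum forms of
rows (a), (b).  Same honest framing.
-/

noncomputable section

open scoped BigOperators Matrix.Norms.L2Operator Topology

namespace Summit.QuantumFields.YangMills.Theorems.BalabanUVNodesPortS1

open Summit.QuantumFields.YangMills.Theorems.K0RecordFormatNames
open Literature.MathematicalPhysics.QuantumFieldTheory.Balaban1983to89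
open Literature.MathematicalPhysics.QuantumFieldTheory.Balaban1983to89.Node00
open Literature.MathematicalPhysics.QuantumFieldTheory.Balaban1983to89.T4Continuum (T4Family)
open NormedSpace (exp)
open _root_.Filter

variable (F : T4Family)

/-! ## §1  The coordinate map `decodeCfg` as a continuous linear map, and its intertwinings -/

/-- `decodeCfg` is (the underlying function of) a continuous `ℂ`-linear map `ℂ^{M} → Sect2.CPair` (a linear re-indexing of
coordinates; finite-dimensional source). [cite: Balaban1987RG1, (1.9) p.262 (bookkeeping)] -/
theorem exists_decodeCLM (K : ℕ) :
    ∃ Lmap : (Fin (recordBondCount F K) → ℂ) →L[ℂ] Sect2.CPair (F.P K) (MatA 2), ∀ u, Lmap u = decodeCfg F K u := by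
  let Llin : (Fin (recordBondCount F K) → ℂ) →ₗ[ℂ] Sect2.CPair (F.P K) (MatA 2) :=
    { toFun := decodeCfg F K
      map_add' := fun u v => by ext b i j <;> simp [decodeCfg]
      map_smul' := fun c u => by ext b i j <;> simp [decodeCfg] }
  exact ⟨LinearMap.toContinuousLinearMap Llin, fun _ => rfl⟩

/-- `decodeCfg` is continuous. [cite: Balaban1987RG1, (1.9) p.262 (bookkeeping)] -/
theorem continuous_decodeCfg (K : ℕ) : Continuous (decodeCfg F K) := by
  obtain ⟨Lmap, hL⟩ := exists_decodeCLM F K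
  have : decodeCfg F K = Lmap := funext fun u => (hL u).symm
  rw [this]
  exact Lmap.continuous

/-- A function of pairs analytic at `decodeCfg u` gives a function of coordinates analytic at `u`.
[cite: Balaban1987RG1, (1.9) p.261 (bookkeeping)] -/
theorem analyticAt_comp_decodeCfg (K : ℕ) {f : Sect2.CPair (F.P K) (MatA 2) → ℂ} {u : Fin (recordBondCount F K) → ℂ}
    (hf : AnalyticAt ℂ f (decodeCfg F K u)) : AnalyticAt ℂ (fun v => f (decodeCfg F K v)) u := by
  obtain ⟨Lmap, hL⟩ := exists_decodeCLM F K
  have hfun : (fun v => f (decodeCfg F K v)) = f ∘ Lmap := funext fun v => by simp [hL]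
  rw [hfun]
  rw [← hL u] at hf
  exact hf.comp (Lmap.analyticAt u)

/-- **`decodeCfg` intertwines the coordinate action `recordAct` with (1.10) on pairs, `Sect2.cAct`.** [cite: Balaban1987RG1, (1.10) p.262] -/
theorem decodeCfg_recordAct (K : ℕ) (u : recordGaugeGrp F K) (c : Fin (recordBondCount F K) → ℂ) :
    decodeCfg F K (recordAct F K u c) = Sect2.cAct u.1 (decodeCfg F K c) := by
  simp [recordAct]

/-- **`decodeCfg` intertwines the coordinate projection `recordCoordProj` with the WINDOW RESTRICTION of pairs** along the site lift
`liftBond` ([I] (1.21) «T^{(j+1)} ↗ Z^d», two volumes). [cite: Balaban1987RG1, (1.21) p.264 (bookkeeping)] -/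
theorem decodeCfg_recordCoordProj (K : ℕ) (u' : Fin (recordBondCount F (K + 1)) → ℂ) :
    decodeCfg F K (recordCoordProj F K u') =
      (fun b => (decodeCfg F (K + 1) u').1 (liftBond F K 0 b), fun b => (decodeCfg F (K + 1) u').2 (liftBond F K 0 b)) := by
  ext b i j <;> simp [decodeCfg, recordCoordProj, liftCfgIdx]

/-- Coordinates agreeing on `recordCoords X` decode to pairs agreeing on the bonds of `X` (`Sect2.agreeOnSet (domSites X)`).
[cite: Balaban1987RG1, (1.7) p.261] -/
theorem agreeOnSet_decodeCfg (Mc k K : ℕ) (X : (recordDomSys F Mc k K).Dom) {u u' : Fin (recordBondCount F K) → ℂ}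
    (h : ∀ i ∈ recordCoords F Mc k K X, u i = u' i) :
    Sect2.agreeOnSet (Sect2.domSites (F.P K) Mc (k + 1) X) (decodeCfg F K u) (decodeCfg F K u') := by
  classical
  intro b hs ht
  have hb : b ∈ domBonds F Mc k K X := ⟨hs, ht⟩
  have key : ∀ (s : PBond (F.P K) 0 ⊕ PBond (F.P K) 0) (i j : Fin 2), Sum.elim id id s ∈ domBonds F Mc k K X →
      u (cfgEquiv F K (s, (i, j))) = u' (cfgEquiv F K (s, (i, j))) := by
    intro s i j hsd
    refine h _ ?_
    simp only [recordCoords, Finset.mem_filter, Finset.mem_univ, true_and, Equiv.symm_apply_apply]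
    exact hsd
  refine ⟨?_, ?_⟩
  · ext i j
    simpa [decodeCfg] using key (Sum.inl b) i j (by simpa using hb)
  · ext i j
    simpa [decodeCfg] using key (Sum.inr b) i j (by simpa using hb)

/-- Membership in the record space read on pairs: `u ∈ recordUc … X` iff `decodeCfg u` lies in the `embedPair`-image of 11b's union
of orbits (definitional). [cite: Balaban1987RG1, (1.11)–(1.16) p.262 (bookkeeping)] -/
theorem mem_recordUc_iff (Mc k : ℕ) (α₀ α₁ : ℝ) (K : ℕ) (X : (recordDomSys F Mc k K).Dom) (u : Fin (recordBondCount F K) → ℂ) :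
    u ∈ recordUc F Mc k α₀ α₁ K X ↔
      decodeCfg F K u ∈ Sect2.embedPair '' B12RegularSpaces111.space' (B12RegularSpaces111SpecialUnitary.suModel 2)
        (Sect2.frameI (RzOfRecord F 2 K) Mc (k + 1) (Sect2.domSites (F.P K) Mc (k + 1) X))
        (B12RegularSpaces111.StepConsts.ofParams (F.P K) (recordCB F) (k + 1)) α₀ α₁ :=
  Iff.rfl

/-- A pair's membership in the record space, read through `encodeCfg` (`decode ∘ encode = id`). [cite: Balaban1987RG1, (1.11)–(1.16) p.262 (bookkeeping)] -/
theorem encodeCfg_mem_recordUc_iff (Mc k : ℕ) (α₀ α₁ : ℝ) (K : ℕ) (X : (recordDomSys F Mc k K).Dom) (φ : Sect2.CPair (F.P K) (MatA 2)) :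
    encodeCfg F K φ ∈ recordUc F Mc k α₀ α₁ K X ↔
      φ ∈ Sect2.embedPair '' B12RegularSpaces111.space' (B12RegularSpaces111SpecialUnitary.suModel 2)
        (Sect2.frameI (RzOfRecord F 2 K) Mc (k + 1) (Sect2.domSites (F.P K) Mc (k + 1) X))
        (B12RegularSpaces111.StepConsts.ofParams (F.P K) (recordCB F) (k + 1)) α₀ α₁ := by
  rw [mem_recordUc_iff, decodeCfg_encodeCfg]

/-! ## §2  ★ The pieces-free half of (1.19) at the record: the spaces are gauge invariant -/

/-- **(1.19), spaces half, AT THE RECORD** — «The spaces U^c_j(X, α₀, α₁) are, by the definition, gauge invariant also» ([I] p. 263):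
the coordinate action `recordAct F K u` of every `SL(2, ℂ)`-valued gauge transformation maps `recordUc … X` into itself.  From 11b's
`B12RegularSpaces111.act_mem_space` (the space is a union of `Gᶜ`-orbits) through `Sect2.cAct_embedPair` and §1.
[cite: Balaban1987RG1, (1.19) p.263, (1.10) p.262] -/
theorem recordUc_mapsTo_recordAct (Mc k : ℕ) (α₀ α₁ : ℝ) (K : ℕ) (u : recordGaugeGrp F K) (X : (recordDomSys F Mc k K).Dom) :
    Set.MapsTo (recordAct F K u) (recordUc F Mc k α₀ α₁ K X) (recordUc F Mc k α₀ α₁ K X) := by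
  intro c hc
  rw [mem_recordUc_iff] at hc ⊢
  obtain ⟨Ψ, hΨ, hΨc⟩ := hc
  rw [decodeCfg_recordAct, ← hΨc, Sect2.cAct_embedPair]
  exact ⟨_, B12RegularSpaces111.act_mem_space hΨ u.2, rfl⟩

/-- The same for the whole shifted family of the signed text (the first conjunct of `GaugeInv119` at the record names, any offset `K₀`).
[cite: Balaban1987RG1, (1.19) p.263] -/
theorem gaugeInv119_spaces_record (Mc k : ℕ) (α₀ α₁ : ℝ) (K₀ : ℕ) :
    ∀ n (u : recordGaugeGrp F (K₀ + n)) (X : (recordDomSys F Mc k (K₀ + n)).Dom),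
      Set.MapsTo (recordAct F (K₀ + n) u) (recordUc F Mc k α₀ α₁ (K₀ + n) X) (recordUc F Mc k α₀ α₁ (K₀ + n) X) :=
  fun n u X => recordUc_mapsTo_recordAct F Mc k α₀ α₁ (K₀ + n) u X

/-! ## §3  ★ The (S1) mould at the record names from rows on configuration pairs -/

/-- **THE COORDINATE DICTIONARY OF THE (S1) MOULD.**  For the record's catalogue, coordinates, action, spaces, locality sets and two-volume
data at the volumes `K₀ + n`, and ANY chart `χ`, functional `Φf`, embedding `ι`: a family of pieces ON PAIRS `Ep n X : Sect2.CPair → ℂ` with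
(a) analyticity at every pair of the record space ([I] p. 261∕263), (b) the bound (1.18) there, (c) (1.7) locality as `Sect2.agreeOnSet`
on the sites of `X`, (d) (1.19) invariance under (1.10) `Sect2.cAct` for `SL(2, ℂ)`-valued gauge transformations, (e) the two-volume
identity off `recordWrap` through the window restriction of pairs ((1.7) with (1.21)), (f) the representation (1.6)–(1.7) of `Φf`
near `0` through `decodeCfg ∘ χ ∘ ι` — yields `B12FormatPlus.FormatPlusG` at the record names with the pieces `Ep n X ∘ decodeCfg`.
Bookkeeping (the content is in (a)–(f)). [cite: Balaban1987RG1, (1.6)–(1.7) and (1.9) p.261, (1.10) p.262, (1.18)–(1.19) p.263, (1.21) p.264] -/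
theorem formatPlusG_record_of_cpairRows (Mc k : ℕ) (α₀ α₁ E₀ κ : ℝ) (K₀ : ℕ) {m : ℕ → ℕ}
    (χ : (n : ℕ) → (recordDomSys F Mc k (K₀ + n)).Dom → (Fin (m n) → ℂ) → (Fin (recordBondCount F (K₀ + n)) → ℂ))
    {W : ℕ → Type*} [∀ n, TopologicalSpace (W n)] [∀ n, Zero (W n)] (Φf : (n : ℕ) → W n → ℂ)
    (ι : (n : ℕ) → W n → (Fin (m n) → ℂ))
    (Ep : (n : ℕ) → (recordDomSys F Mc k (K₀ + n)).Dom → Sect2.CPair (F.P (K₀ + n)) (MatA 2) → ℂ)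
    (hA : ∀ n X φ, encodeCfg F (K₀ + n) φ ∈ recordUc F Mc k α₀ α₁ (K₀ + n) X → AnalyticAt ℂ (Ep n X) φ)
    (hB : ∀ n X φ, encodeCfg F (K₀ + n) φ ∈ recordUc F Mc k α₀ α₁ (K₀ + n) X →
      ‖Ep n X φ‖ ≤ E₀ * Real.exp (-κ * (recordDomSys F Mc k (K₀ + n)).dj X))
    (hL : ∀ n X φ ψ, Sect2.agreeOnSet (Sect2.domSites (F.P (K₀ + n)) Mc (k + 1) X) φ ψ → Ep n X φ = Ep n X ψ)
    (hG : ∀ n X (u : recordGaugeGrp F (K₀ + n)) φ, Ep n X (Sect2.cAct u.1 φ) = Ep n X φ)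
    (hV : ∀ n X, X ∉ recordWrap F Mc k (K₀ + n) → ∀ φ' : Sect2.CPair (F.P (K₀ + n + 1)) (MatA 2),
      Ep (n + 1) (recordDomEmb F Mc k (K₀ + n) X) φ' =
        Ep n X (fun b => φ'.1 (liftBond F (K₀ + n) 0 b), fun b => φ'.2 (liftBond F (K₀ + n) 0 b)))
    (hR : ∀ n, ∀ᶠ B in 𝓝 (0 : W n), Φf n B = ∑ X, Ep n X (decodeCfg F (K₀ + n) (χ n X (ι n B)))) :
    B12FormatPlus.FormatPlusG (fun n => recordDomSys F Mc k (K₀ + n)) (fun n => recordBondCount F (K₀ + n))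
      (fun n => recordAct F (K₀ + n)) (fun n => recordUc F Mc k α₀ α₁ (K₀ + n)) (fun n => recordCoords F Mc k (K₀ + n)) m χ Φf ι
      (fun n => recordWrap F Mc k (K₀ + n)) (fun n => recordDomEmb F Mc k (K₀ + n)) (fun n _ => recordCoordProj F (K₀ + n)) E₀ κ := by
  refine ⟨fun n X u => Ep n X (decodeCfg F (K₀ + n) u), ?_, ?_, ?_, hR, ?_, ?_⟩
  · -- Analytic19
    intro n X u hu
    have hu' : encodeCfg F (K₀ + n) (decodeCfg F (K₀ + n) u) ∈ recordUc F Mc k α₀ α₁ (K₀ + n) X := by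
      rwa [encodeCfg_decodeCfg]
    exact analyticAt_comp_decodeCfg F (K₀ + n) (hA n X _ hu')
  · -- Bound118
    intro n X u hu
    have hu' : encodeCfg F (K₀ + n) (decodeCfg F (K₀ + n) u) ∈ recordUc F Mc k α₀ α₁ (K₀ + n) X := by
      rwa [encodeCfg_decodeCfg]
    exact hB n X _ hu'
  · -- Local17
    intro n X u u' h
    exact hL n X _ _ (agreeOnSet_decodeCfg F Mc k (K₀ + n) X h)
  · -- PieceVolIndep
    intro n X hX u'
    show Ep (n + 1) (recordDomEmb F Mc k (K₀ + n) X) (decodeCfg F (K₀ + n + 1) u') =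
      Ep n X (decodeCfg F (K₀ + n) (recordCoordProj F (K₀ + n) u'))
    rw [hV n X hX, decodeCfg_recordCoordProj]
  · -- GaugeInv119
    refine ⟨gaugeInv119_spaces_record F Mc k α₀ α₁ K₀, fun n u X c => ?_⟩
    show Ep n X (decodeCfg F (K₀ + n) (recordAct F (K₀ + n) u c)) = Ep n X (decodeCfg F (K₀ + n) c)
    rw [decodeCfg_recordAct, hG]

/-! ## §4  Receipts about the SIGNED chart `recordChart` (for the critic; see the porter's PORT-PLAN §0) -/

/-- **The `𝐉`-component of the signed chart is identically zero**: `recordChart` feeds the pieces the pair `(𝐔, 0)`.  Print's (1.9)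
evaluates the pieces at `(U_j, 𝐉_j)` with `𝐉_j = (1.8)(U_j)` the current `D^{ξ*}_{U_j} ξ⁻² π Im ∂U_j` (tree: `B12Eq18Current.ofBackground`),
which is small at a minimiser but not zero.  Recorded, not judged, here. [cite: Balaban1987RG1, (1.8)–(1.9) p.261] -/
theorem decodeCfg_recordChart_snd (Mc k K : ℕ) (X : (recordDomSys F Mc k K).Dom) (w : Fin (recordChartDim F K) → ℂ) :
    (decodeCfg F K (recordChart F Mc k K X w)).2 = fun _ => 0 := by
  classical
  simp [recordChart]

/-- Off the bonds of `X` the `𝐔`-component of the signed chart is the unit. [cite: Balaban1987RG1, (1.7) p.261, (4.4) p.281 (bookkeeping)] -/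
theorem decodeCfg_recordChart_fst_of_not_mem (Mc k K : ℕ) (X : (recordDomSys F Mc k K).Dom) (w : Fin (recordChartDim F K) → ℂ)
    {b : PBond (F.P K) 0} (hb : b ∉ domBonds F Mc k K X) : (decodeCfg F K (recordChart F Mc k K X w)).1 b = 1 := by
  classical
  simp [recordChart, hb]

/-- On the bonds of `X` the `𝐔`-component of the signed chart is the exponential of the charted 𝔰𝔩₂(ℂ) element.
[cite: Balaban1987RG1, p.258 («U_k = exp(iηH′)»), (4.4) p.281 (bookkeeping)] -/
theorem decodeCfg_recordChart_fst_of_mem (Mc k K : ℕ) (X : (recordDomSys F Mc k K).Dom) (w : Fin (recordChartDim F K) → ℂ)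
    {b : PBond (F.P K) 0} (hb : b ∈ domBonds F Mc k K X) : (decodeCfg F K (recordChart F Mc k K X w)).1 b = exp (chartMat F K w b) := by
  classical
  simp [recordChart, hb]

/-! ## §5  (v2 APPEND, after the RE-SIGNATURE 27930⁶ of 2026-08-30T22:43Z — DEF-1 edition 5's CENTRED two-volume layer `…Ctr`) the same
dictionary with `recordWrapCtr ∕ recordDomEmbCtr ∕ recordCoordProjCtr` and the centred bond lift `liftBondCtr` -/

/-- **`decodeCfg` intertwines the CENTRED coordinate projection `recordCoordProjCtr` with the window restriction of pairs along `liftBondCtr`.**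
[cite: Balaban1987RG1, (1.21) p.264 (bookkeeping)] -/
theorem decodeCfg_recordCoordProjCtr (K : ℕ) (u' : Fin (recordBondCount F (K + 1)) → ℂ) :
    decodeCfg F K (recordCoordProjCtr F K u') =
      (fun b => (decodeCfg F (K + 1) u').1 (liftBondCtr F K 0 b), fun b => (decodeCfg F (K + 1) u').2 (liftBondCtr F K 0 b)) := by
  ext b i j <;> simp [decodeCfg, recordCoordProjCtr, liftCfgIdxCtr]

/-- **THE COORDINATE DICTIONARY OF THE (S1) MOULD, CENTRED LAYER** — `formatPlusG_record_of_cpairRows` verbatim with the text-of-record's two-volume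
names `recordWrapCtr ∕ recordDomEmbCtr ∕ recordCoordProjCtr` (27930⁶) and the two-volume hypothesis (e) through the CENTRED window restriction of pairs;
generic in `(m, χ, Φf, ι, K₀)`.  Bookkeeping. [cite: Balaban1987RG1, (1.6)–(1.7) and (1.9) p.261, (1.10) p.262, (1.18)–(1.19) p.263, (1.21) p.264] -/
theorem formatPlusG_record_of_cpairRowsCtr (Mc k : ℕ) (α₀ α₁ E₀ κ : ℝ) (K₀ : ℕ) {m : ℕ → ℕ}
    (χ : (n : ℕ) → (recordDomSys F Mc k (K₀ + n)).Dom → (Fin (m n) → ℂ) → (Fin (recordBondCount F (K₀ + n)) → ℂ))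
    {W : ℕ → Type*} [∀ n, TopologicalSpace (W n)] [∀ n, Zero (W n)] (Φf : (n : ℕ) → W n → ℂ)
    (ι : (n : ℕ) → W n → (Fin (m n) → ℂ))
    (Ep : (n : ℕ) → (recordDomSys F Mc k (K₀ + n)).Dom → Sect2.CPair (F.P (K₀ + n)) (MatA 2) → ℂ)
    (hA : ∀ n X φ, encodeCfg F (K₀ + n) φ ∈ recordUc F Mc k α₀ α₁ (K₀ + n) X → AnalyticAt ℂ (Ep n X) φ)
    (hB : ∀ n X φ, encodeCfg F (K₀ + n) φ ∈ recordUc F Mc k α₀ α₁ (K₀ + n) X →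
      ‖Ep n X φ‖ ≤ E₀ * Real.exp (-κ * (recordDomSys F Mc k (K₀ + n)).dj X))
    (hL : ∀ n X φ ψ, Sect2.agreeOnSet (Sect2.domSites (F.P (K₀ + n)) Mc (k + 1) X) φ ψ → Ep n X φ = Ep n X ψ)
    (hG : ∀ n X (u : recordGaugeGrp F (K₀ + n)) φ, Ep n X (Sect2.cAct u.1 φ) = Ep n X φ)
    (hV : ∀ n X, X ∉ recordWrapCtr F Mc k (K₀ + n) → ∀ φ' : Sect2.CPair (F.P (K₀ + n + 1)) (MatA 2),
      Ep (n + 1) (recordDomEmbCtr F Mc k (K₀ + n) X) φ' =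
        Ep n X (fun b => φ'.1 (liftBondCtr F (K₀ + n) 0 b), fun b => φ'.2 (liftBondCtr F (K₀ + n) 0 b)))
    (hR : ∀ n, ∀ᶠ B in 𝓝 (0 : W n), Φf n B = ∑ X, Ep n X (decodeCfg F (K₀ + n) (χ n X (ι n B)))) :
    B12FormatPlus.FormatPlusG (fun n => recordDomSys F Mc k (K₀ + n)) (fun n => recordBondCount F (K₀ + n))
      (fun n => recordAct F (K₀ + n)) (fun n => recordUc F Mc k α₀ α₁ (K₀ + n)) (fun n => recordCoords F Mc k (K₀ + n)) m χ Φf ι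
      (fun n => recordWrapCtr F Mc k (K₀ + n)) (fun n => recordDomEmbCtr F Mc k (K₀ + n)) (fun n _ => recordCoordProjCtr F (K₀ + n)) E₀ κ := by
  refine ⟨fun n X u => Ep n X (decodeCfg F (K₀ + n) u), ?_, ?_, ?_, hR, ?_, ?_⟩
  · intro n X u hu
    have hu' : encodeCfg F (K₀ + n) (decodeCfg F (K₀ + n) u) ∈ recordUc F Mc k α₀ α₁ (K₀ + n) X := by
      rwa [encodeCfg_decodeCfg]
    exact analyticAt_comp_decodeCfg F (K₀ + n) (hA n X _ hu')
  · intro n X u hu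
    have hu' : encodeCfg F (K₀ + n) (decodeCfg F (K₀ + n) u) ∈ recordUc F Mc k α₀ α₁ (K₀ + n) X := by
      rwa [encodeCfg_decodeCfg]
    exact hB n X _ hu'
  · intro n X u u' h
    exact hL n X _ _ (agreeOnSet_decodeCfg F Mc k (K₀ + n) X h)
  · intro n X hX u'
    show Ep (n + 1) (recordDomEmbCtr F Mc k (K₀ + n) X) (decodeCfg F (K₀ + n + 1) u') =
      Ep n X (decodeCfg F (K₀ + n) (recordCoordProjCtr F (K₀ + n) u'))
    rw [hV n X hX, decodeCfg_recordCoordProjCtr]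
  · refine ⟨gaugeInv119_spaces_record F Mc k α₀ α₁ K₀, fun n u X c => ?_⟩
    show Ep n X (decodeCfg F (K₀ + n) (recordAct F (K₀ + n) u c)) = Ep n X (decodeCfg F (K₀ + n) c)
    rw [decodeCfg_recordAct, hG]

/-! ## §6  (v3 APPEND) THE CHART ROUND TRIP, algebra half: the 𝔰𝔩₂-coordinates resum to the traceless part; `chartMat ∘ recordEmb = mlog ∘ U_{k+1}` up to the trace
(the (S1) row (f) reads `exp (chartMat (ι B) b)`; with `exp_mlog` this is `U_{k+1}(W_B)_b` once `tr (mlog U) = 0` — the SU(2) trace lemma is the analysis half, next) -/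

/-- **The 𝔰𝔩₂-coordinates resum to the traceless part**: `Σ_a (sl2Coord A)_a • τ_a = A − (tr A ∕ 2)·1` for every `2 × 2` complex matrix.
[cite: Balaban1987RG1, (1.10) p.262 (the algebra 𝔤ᶜ; bookkeeping)] -/
theorem sum_sl2Coord_smul_sl2Gen (A : MatA 2) : ∑ a : Fin 3, sl2Coord A a • sl2Gen a = A - (A.trace / 2) • (1 : MatA 2) := by
  ext i j
  simp only [Fin.sum_univ_three, sl2Coord, sl2Gen, Matrix.trace, Fin.sum_univ_two, Matrix.diag_apply]
  fin_cases i <;> fin_cases j <;> simp <;> ring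

/-- For a TRACELESS `2 × 2` matrix the 𝔰𝔩₂-coordinates resum to the matrix itself. [cite: Balaban1987RG1, (1.10) p.262 (bookkeeping)] -/
theorem sum_sl2Coord_smul_sl2Gen_of_trace_eq_zero {A : MatA 2} (hA : A.trace = 0) : ∑ a : Fin 3, sl2Coord A a • sl2Gen a = A := by
  rw [sum_sl2Coord_smul_sl2Gen, hA, zero_div, zero_smul, sub_zero]

/-- **The chart matrix of a coordinate vector READ OFF a bond-indexed matrix family is the traceless part of that family, bondwise**:
`chartMat (i ↦ sl2Coord (A (bond i)) (colour i)) b = A b − (tr (A b) ∕ 2)·1`. [cite: Balaban1987RG1, p.258 («U_k = exp(iηH′)»; bookkeeping)] -/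
theorem chartMat_sl2Coord (K : ℕ) (A : PBond (F.P K) 0 → MatA 2) (b : PBond (F.P K) 0) :
    chartMat F K (fun i => sl2Coord (A ((chartEquiv F K).symm i).1) ((chartEquiv F K).symm i).2) b = A b - ((A b).trace / 2) • (1 : MatA 2) := by
  simp only [chartMat, Equiv.symm_apply_apply]
  exact sum_sl2Coord_smul_sl2Gen (A b)

/-- The same for a traceless family: the chart matrix IS the family. [cite: Balaban1987RG1, p.258 (bookkeeping)] -/
theorem chartMat_sl2Coord_of_trace_eq_zero (K : ℕ) (A : PBond (F.P K) 0 → MatA 2) (hA : ∀ b, (A b).trace = 0) (b : PBond (F.P K) 0) :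
    chartMat F K (fun i => sl2Coord (A ((chartEquiv F K).symm i).1) ((chartEquiv F K).symm i).2) b = A b := by
  rw [chartMat_sl2Coord, hA b, zero_div, zero_smul, sub_zero]

/-- **The coordinate embedding read back through the chart matrix**: `chartMat (recordEmb … B) b = mlog (U_b) − (tr (mlog U_b) ∕ 2)·1` with
`U = recordBgField … B` the background field of the charted configuration in the rooted gauge. [cite: Balaban1987RG1, p.258, (4.35) p.290 (bookkeeping)] -/
theorem chartMat_recordEmb (θ : Stage13Params F 2) (k K : ℕ) (B : Fin (F.P K).d → Site (F.P K) (k + 1) → θ.Vβ) (b : PBond (F.P K) 0) :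
    chartMat F K (recordEmb F θ k K B) b =
      MatrixLog.mlog ((recordBgField F θ k K B b : SU 2) : MatA 2) - ((MatrixLog.mlog ((recordBgField F θ k K B b : SU 2) : MatA 2)).trace / 2) • (1 : MatA 2) :=
  chartMat_sl2Coord F K (fun b' => MatrixLog.mlog ((recordBgField F θ k K B b' : SU 2) : MatA 2)) b

/-! ## §7  (v4 APPEND, porter gen 2) CPair-ROWS ADDITIVITY — the pieces of the (S1) assembly are SUMS `Ep = LZ + FE` of two families on pairs
([I] p. 261 L22–24: the localized representation of `log Z^{(k)}(𝐔, 𝐉)|_X` from [16] (63), PLUS the pieces of `E^{(k+1)}` of (2.12)–(2.13) ∕ [II]): rows (a)–(e)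
hold for the sum when they hold for each family, the (1.18) constants ADD, and row (f) is asked of the sum only -/

/-- **THE (S1) MOULD AT THE RECORD NAMES (centred two-volume layer) FROM TWO PIECE FAMILIES ON PAIRS.**  If `P n X` and `Q n X : Sect2.CPair → ℂ` each
satisfy rows (a) analyticity on the record space, (b) the bound (1.18) with constants `E₁`, `E₂` (same `κ`), (c) (1.7) locality, (d) (1.19) invariance and
(e) the two-volume identity through the centred window restriction, and (f) the functional is represented near `0` by the SUM `Σ_X (P n X + Q n X)` read through
`decodeCfg ∘ χ ∘ ι`, then `B12FormatPlus.FormatPlusG` holds at the record names with pieces `(P n X + Q n X) ∘ decodeCfg` and constant `E₁ + E₂`.  This is the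
shape in which the port assembles (1.6): `Ep := LZ + FE` (the [16] (63) pieces of `log Z^{(k)}` and the [II] pieces of `E^{(k+1)}`).  Bookkeeping over
`formatPlusG_record_of_cpairRowsCtr`. [cite: Balaban1987RG1, (1.6)–(1.7) p.261 (with p.261 L22–24), (2.12)–(2.13) p.268, (1.18)–(1.19) p.263, (1.21) p.264] -/
theorem formatPlusG_record_of_cpairRowsCtr_add (Mc k : ℕ) (α₀ α₁ E₁ E₂ κ : ℝ) (K₀ : ℕ) {m : ℕ → ℕ}
    (χ : (n : ℕ) → (recordDomSys F Mc k (K₀ + n)).Dom → (Fin (m n) → ℂ) → (Fin (recordBondCount F (K₀ + n)) → ℂ))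
    {W : ℕ → Type*} [∀ n, TopologicalSpace (W n)] [∀ n, Zero (W n)] (Φf : (n : ℕ) → W n → ℂ)
    (ι : (n : ℕ) → W n → (Fin (m n) → ℂ))
    (P Q : (n : ℕ) → (recordDomSys F Mc k (K₀ + n)).Dom → Sect2.CPair (F.P (K₀ + n)) (MatA 2) → ℂ)
    (hA₁ : ∀ n X φ, encodeCfg F (K₀ + n) φ ∈ recordUc F Mc k α₀ α₁ (K₀ + n) X → AnalyticAt ℂ (P n X) φ)
    (hA₂ : ∀ n X φ, encodeCfg F (K₀ + n) φ ∈ recordUc F Mc k α₀ α₁ (K₀ + n) X → AnalyticAt ℂ (Q n X) φ)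
    (hB₁ : ∀ n X φ, encodeCfg F (K₀ + n) φ ∈ recordUc F Mc k α₀ α₁ (K₀ + n) X →
      ‖P n X φ‖ ≤ E₁ * Real.exp (-κ * (recordDomSys F Mc k (K₀ + n)).dj X))
    (hB₂ : ∀ n X φ, encodeCfg F (K₀ + n) φ ∈ recordUc F Mc k α₀ α₁ (K₀ + n) X →
      ‖Q n X φ‖ ≤ E₂ * Real.exp (-κ * (recordDomSys F Mc k (K₀ + n)).dj X))
    (hL₁ : ∀ n X φ ψ, Sect2.agreeOnSet (Sect2.domSites (F.P (K₀ + n)) Mc (k + 1) X) φ ψ → P n X φ = P n X ψ)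
    (hL₂ : ∀ n X φ ψ, Sect2.agreeOnSet (Sect2.domSites (F.P (K₀ + n)) Mc (k + 1) X) φ ψ → Q n X φ = Q n X ψ)
    (hG₁ : ∀ n X (u : recordGaugeGrp F (K₀ + n)) φ, P n X (Sect2.cAct u.1 φ) = P n X φ)
    (hG₂ : ∀ n X (u : recordGaugeGrp F (K₀ + n)) φ, Q n X (Sect2.cAct u.1 φ) = Q n X φ)
    (hV₁ : ∀ n X, X ∉ recordWrapCtr F Mc k (K₀ + n) → ∀ φ' : Sect2.CPair (F.P (K₀ + n + 1)) (MatA 2),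
      P (n + 1) (recordDomEmbCtr F Mc k (K₀ + n) X) φ' =
        P n X (fun b => φ'.1 (liftBondCtr F (K₀ + n) 0 b), fun b => φ'.2 (liftBondCtr F (K₀ + n) 0 b)))
    (hV₂ : ∀ n X, X ∉ recordWrapCtr F Mc k (K₀ + n) → ∀ φ' : Sect2.CPair (F.P (K₀ + n + 1)) (MatA 2),
      Q (n + 1) (recordDomEmbCtr F Mc k (K₀ + n) X) φ' =
        Q n X (fun b => φ'.1 (liftBondCtr F (K₀ + n) 0 b), fun b => φ'.2 (liftBondCtr F (K₀ + n) 0 b)))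
    (hR : ∀ n, ∀ᶠ B in 𝓝 (0 : W n),
      Φf n B = ∑ X, (P n X (decodeCfg F (K₀ + n) (χ n X (ι n B))) + Q n X (decodeCfg F (K₀ + n) (χ n X (ι n B))))) :
    B12FormatPlus.FormatPlusG (fun n => recordDomSys F Mc k (K₀ + n)) (fun n => recordBondCount F (K₀ + n))
      (fun n => recordAct F (K₀ + n)) (fun n => recordUc F Mc k α₀ α₁ (K₀ + n)) (fun n => recordCoords F Mc k (K₀ + n)) m χ Φf ι
      (fun n => recordWrapCtr F Mc k (K₀ + n)) (fun n => recordDomEmbCtr F Mc k (K₀ + n)) (fun n _ => recordCoordProjCtr F (K₀ + n))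
      (E₁ + E₂) κ := by
  refine formatPlusG_record_of_cpairRowsCtr F Mc k α₀ α₁ (E₁ + E₂) κ K₀ χ Φf ι (fun n X φ => P n X φ + Q n X φ)
    (fun n X φ hφ => (hA₁ n X φ hφ).add (hA₂ n X φ hφ)) (fun n X φ hφ => ?_)
    (fun n X φ ψ h => by rw [hL₁ n X φ ψ h, hL₂ n X φ ψ h]) (fun n X u φ => by rw [hG₁, hG₂])
    (fun n X hX φ' => by rw [hV₁ n X hX, hV₂ n X hX]) hR
  calc ‖P n X φ + Q n X φ‖ ≤ ‖P n X φ‖ + ‖Q n X φ‖ := norm_add_le _ _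
    _ ≤ E₁ * Real.exp (-κ * (recordDomSys F Mc k (K₀ + n)).dj X) + E₂ * Real.exp (-κ * (recordDomSys F Mc k (K₀ + n)).dj X) :=
        add_le_add (hB₁ n X φ hφ) (hB₂ n X φ hφ)
    _ = (E₁ + E₂) * Real.exp (-κ * (recordDomSys F Mc k (K₀ + n)).dj X) := by ring

/-- **Row-wise additivity of the (1.18) bound alone** (for chaining more than two families: `Σ_{s ∈ S} P_s` with constants `Σ E_s`), on any set of
pairs. [cite: Balaban1987RG1, (1.18) p.263 (bookkeeping)] -/
theorem bound118_cpair_sum {ιS : Type*} (S : Finset ιS) {K : ℕ} (Dm : Set (Sect2.CPair (F.P K) (MatA 2))) (r : ℝ)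
    (Pf : ιS → Sect2.CPair (F.P K) (MatA 2) → ℂ) (Ec : ιS → ℝ)
    (hB : ∀ s ∈ S, ∀ φ ∈ Dm, ‖Pf s φ‖ ≤ Ec s * r) (φ : Sect2.CPair (F.P K) (MatA 2)) (hφ : φ ∈ Dm) :
    ‖∑ s ∈ S, Pf s φ‖ ≤ (∑ s ∈ S, Ec s) * r := by
  calc ‖∑ s ∈ S, Pf s φ‖ ≤ ∑ s ∈ S, ‖Pf s φ‖ := norm_sum_le _ _
    _ ≤ ∑ s ∈ S, Ec s * r := Finset.sum_le_sum fun s hs => hB s hs φ hφ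
    _ = (∑ s ∈ S, Ec s) * r := by rw [Finset.sum_mul]

/-- **Row-wise additivity of analyticity** for a finite family of pieces on pairs. [cite: Balaban1987RG1, (1.19) p.263 (bookkeeping)] -/
theorem analyticAt_cpair_sum {ιS : Type*} (S : Finset ιS) {K : ℕ} (Pf : ιS → Sect2.CPair (F.P K) (MatA 2) → ℂ)
    (φ : Sect2.CPair (F.P K) (MatA 2)) (hA : ∀ s ∈ S, AnalyticAt ℂ (Pf s) φ) :
    AnalyticAt ℂ (fun ψ => ∑ s ∈ S, Pf s ψ) φ :=
  Finset.analyticAt_fun_sum S hA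

end Summit.QuantumFields.YangMills.Theorems.BalabanUVNodesPortS1

end
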